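import Literature.AlgebraicGeometry.Motives.HodgeStructureCentralizerInternalBlocks
import HarnessLib

/-!
# MILNE'S PROP. 1.5 INTERNALLY: the Lefschetz group `S(H)(ℚ) = {g ∈ C(H) ∣ g†g = 1}` of a polarized `ℚ`-Hodge structure ALONG
# AN INTERNAL DIRECT SUM `V = ⊕_k W_k` of sub-Hodge structures — every `g ∈ S(H)(ℚ)` preserves each block and restricts to
# `S(W_k)(ℚ)` (for `ψ|_{W_k}`), `S(H)(ℚ) ↪ Π_k S(W_k)(ℚ)` for ANY internal sum, and `S(H)(ℚ) ≃* Π_k S(W_k)(ℚ)` for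
# Hom-orthogonal blocks — in particular for `E_φ`-stable blocks and for the CANONICAL blocks (the minimal `E_φ`-stable
# sub-Hodge structures): «Any such isogeny induces an isomorphism `S(A₁) × ⋯ × S(A_s) → S(A)`» (Milne 1999, Prop. 1.5)

[topic AlgebraicGeometry/Motives]

Layer `Literature/AlgebraicGeometry/Motives`, lane `lit-hodgefound` (Track 2 foundations library; prover seat
`lit-hodgefound-p02`, generation 52, self-proposed row g52-#4). THEOREMS ONLY: no definition, no named fact (net debt `0`),
no instance, no notation.  Joins, BY NAME (nothing restated): the Lefschetz group `Polarization.lefschetzGroup`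
(`S(H)(ℚ) ≤ GL(V)`: commutes with `E_φ`, preserves `ψ`; p34 g18-#1 `Motives/HodgeStructureLefschetzGroupPoints`,
`Polarization.mem_lefschetzGroup_iff`, `forall_endAlg_apply_iff_coe_mem_centralizer_endAlg`), g52-#3
`Motives/HodgeStructureCentralizerInternalBlocks` (`apply_mem_of_mem_centralizer_endAlg`, the gluing
`sum_comp_mem_centralizer_endAlg_of_hom_orthogonal` and its evaluation `sum_subtype_comp_comp_codRestrict_apply_of_mem`,
`hom_eq_zero_of_forall_stable`, `isInternalProj_mem_endAlg'`), «Hom-orthogonal blocks are `ψ`-orthogonal for every `ψ`» and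
«`ψ = Σ_k ψ|_{W_k} ∘ π_k`» (`Polarization.form_apply_eq_zero_of_pairwise_hom_eq_zero`,
`Polarization.glueFamily_restrict_eq_of_pairwise_hom_eq_zero`, `Polarization.glueFamily_form_apply`;
`Motives/HodgeStructureHomOrthogonalPolarizations`, `Motives/HodgeStructureInternalDirectSumPolarizations`), extension by zero
(`SubHodgeStructure.exists_mem_endAlg_apply_eq_apply_eq_zero`), non-degeneracy (`Polarization.nondegenerate`), and the
canonical blocks (g51-#8∕#9).  The tree has Prop. 1.5 for EXTERNAL sums and powers (`Motives/HodgeStructureLefschetzGroupDirectSum`,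
`…FiniteDirectSum`, `…SimpleIsogenyFactors`: `H₁.prod H₂`, `HodgeStructure.pi`); this is the internal form, which is the one
the canonical blocks of one `H` come in.

## The source, verbatim

J. S. Milne, *Lefschetz classes on abelian varieties*, Duke Math. J. 96 (1999) 639–675 [Milne1999LefschetzClasses] (held
`paper:doi-10-1215-s0012-7094-99-09620-5`), §1 p. 644: "let `S(A)` be the algebraic group over `ℚ` such that, for all
commutative `ℚ`-algebras `R`, `S(A)(R) = {γ ∈ C(A) ⊗ R ∣ γ†γ = 1}`"; "**Proposition 1.5.** Let `A₁, …, A_s` be a set of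
representatives for the simple isogeny factors of `A`, so that there exists an isogeny `A₁^{r₁} × ⋯ × A_s^{r_s} → A` for some
`rᵢ > 0`. Any such isogeny induces an isomorphism `S(A₁) × ⋯ × S(A_s) → S(A)`, which is independent of the choice of the
isogeny. Proof. This is an immediate consequence of Proposition 1.1."; p. 643: "`C(A) ⊂ C(A₁) × ⋯ × C(A_s)`, with equality
holding if and only if `Hom(Aᵢ, Aⱼ) = 0`".  H. Lange, *Abelian Varieties over the Complex Numbers* [Lange2023AbelianVarietiesComplex]
§7.2.4 Exercise (4) (the Lefschetz group of a polarized abelian variety); C. Voisin, *Hodge Theory and Complex Algebraic Geometry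
I* [VoisinHodgeI2002] §7.3.1 Lemma 7.26 (projections are morphisms).

## Dictionary and what is proved (namespace `Literature.AlgebraicGeometry.Motives.HodgeStructure`)

`S(H)(ℚ) = ψ.lefschetzGroup ≤ (V ≃ₗ[ℚ] V)`; for a sub-Hodge structure `W`, `S(W)(ℚ) = (ψ.restrict W).lefschetzGroup`; the
restriction of `g ∈ S(H)(ℚ)` to a block is `g.ofSubmodules W_k W_k _ : W_k ≃ₗ[ℚ] W_k` (Mathlib).

* §1 (any internal sum) **`Polarization.apply_mem_of_mem_lefschetzGroup`** (`g W_k ⊆ W_k`), `Polarization.map_eq_of_mem_lefschetzGroup`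
  (`g W_k = W_k`), **`Polarization.ofSubmodules_mem_lefschetzGroup_restrict`** (`g|_{W_k} ∈ S(W_k)(ℚ)`),
  **`Polarization.exists_monoidHom_pi_lefschetzGroup`** (the restriction homomorphism `S(H)(ℚ) →* Π_k S(W_k)(ℚ)` exists and is
  INJECTIVE).
* §2 (Hom-orthogonal blocks) `Polarization.form_eq_sum_isInternalProj_of_hom_orthogonal` (`ψ(v, w) = Σ_k ψ(π_k v, π_k w)`),
  **`Polarization.exists_mem_lefschetzGroup_forall_apply_eq_of_hom_orthogonal`** (gluing: every family `(γ_k ∈ S(W_k)(ℚ))_k` is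
  the family of restrictions of some `g ∈ S(H)(ℚ)`), **`Polarization.exists_mulEquiv_pi_lefschetzGroup_of_hom_orthogonal`**
  (`S(H)(ℚ) ≃* Π_k S(W_k)(ℚ)`), `Polarization.exists_mulEquiv_pi_lefschetzGroup_of_forall_stable` (`E_φ`-stable blocks).
* §3 (canonical blocks) **`Polarization.exists_mulEquiv_pi_lefschetzGroup_minimal_stable`** — Prop. 1.5 intrinsically:
  `S(H)(ℚ) ≃* Π_i S(S_i)(ℚ)` over the minimal `E_φ`-stable sub-Hodge structures `S_i` with their restricted polarizations.
-/

noncomputable section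

namespace Literature.AlgebraicGeometry.Motives

namespace HodgeStructure

universe u

variable {V : Type u} [AddCommGroup V] [Module ℚ V] [Module.Finite ℚ V] {n : ℤ} {H : HodgeStructure V n}

section Blocks

variable {κ : Type*} [Fintype κ] [DecidableEq κ] (W : κ → SubHodgeStructure H)
  (hW : DirectSum.IsInternal fun k => (W k).toSubmodule)

include hW

/-! ## §1 `g ∈ S(H)(ℚ)` preserves the blocks and restricts to `S(W_k)(ℚ)`; `S(H)(ℚ) ↪ Π_k S(W_k)(ℚ)` -/

omit [Module.Finite ℚ V] [Fintype κ] in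
/-- **`g ∈ S(H)(ℚ)` maps each block `W_k` into itself** (`g` commutes with the Hodge endomorphism `π_k`).
[cite: Milne1999LefschetzClasses, §1 p. 643–644] [cite: VoisinHodgeI2002, §7.3.1 Lemma 7.26] -/
theorem Polarization.apply_mem_of_mem_lefschetzGroup (ψ : Polarization H) {g : V ≃ₗ[ℚ] V} (hg : g ∈ ψ.lefschetzGroup)
    (k : κ) {v : V} (hv : v ∈ (W k).toSubmodule) : g v ∈ (W k).toSubmodule :=
  apply_mem_of_mem_centralizer_endAlg W hW
    ((forall_endAlg_apply_iff_coe_mem_centralizer_endAlg H g).1 ((ψ.mem_lefschetzGroup_iff g).1 hg).1) k hv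

omit [Module.Finite ℚ V] [Fintype κ] in
/-- `g W_k = W_k` for `g ∈ S(H)(ℚ)` (apply §1 to `g` and to `g⁻¹ ∈ S(H)(ℚ)`). [cite: Milne1999LefschetzClasses, §1 p. 643–644] -/
theorem Polarization.map_eq_of_mem_lefschetzGroup (ψ : Polarization H) {g : V ≃ₗ[ℚ] V} (hg : g ∈ ψ.lefschetzGroup)
    (k : κ) : (W k).toSubmodule.map (g : V →ₗ[ℚ] V) = (W k).toSubmodule := by
  refine le_antisymm ?_ fun v hv => ?_
  · rintro _ ⟨v, hv, rfl⟩
    exact ψ.apply_mem_of_mem_lefschetzGroup W hW hg k hv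
  · exact ⟨g⁻¹ v, ψ.apply_mem_of_mem_lefschetzGroup W hW (inv_mem hg) k hv, g.apply_symm_apply v⟩

omit [Module.Finite ℚ V] [Fintype κ] in
/-- **The restriction `g|_{W_k}` of `g ∈ S(H)(ℚ)` lies in `S(W_k)(ℚ)`** (for the restricted polarization `ψ|_{W_k}`): it commutes
with `E_φ(W_k)` (every `b ∈ E_φ(W_k)` extends by zero to `E_φ(H)`) and preserves `ψ|_{W_k} = ψ` on `W_k`.
[cite: Milne1999LefschetzClasses, §1 p. 643–644 and Prop. 1.5] [cite: Lange2023AbelianVarietiesComplex, §2.4.4 proof of Cor. 2.4.26 (p. 124)] -/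
theorem Polarization.ofSubmodules_mem_lefschetzGroup_restrict (ψ : Polarization H) {g : V ≃ₗ[ℚ] V}
    (hg : g ∈ ψ.lefschetzGroup) (k : κ) :
    g.ofSubmodules (W k).toSubmodule (W k).toSubmodule (ψ.map_eq_of_mem_lefschetzGroup W hW hg k) ∈
      (ψ.restrict (W k)).lefschetzGroup := by
  refine ((ψ.restrict (W k)).mem_lefschetzGroup_iff _).2 ⟨fun b v => ?_, fun v w => ?_⟩
  · obtain ⟨a, ha, hab, -⟩ := (W k).exists_mem_endAlg_apply_eq_apply_eq_zero _
      (SubHodgeStructure.isCompl_iSup'_ne W hW k) b.2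
    apply Subtype.ext
    rw [← hab, LinearEquiv.ofSubmodules_apply, LinearEquiv.ofSubmodules_apply, ← hab]
    exact ((ψ.mem_lefschetzGroup_iff g).1 hg).1 ⟨a, ha⟩ v
  · rw [Polarization.restrict_form_apply, Polarization.restrict_form_apply, LinearEquiv.ofSubmodules_apply,
      LinearEquiv.ofSubmodules_apply]
    exact ((ψ.mem_lefschetzGroup_iff g).1 hg).2 v w

omit [Module.Finite ℚ V] in
/-- **«`C(A) ⊂ C(A₁) × ⋯ × C(A_s)`» for the Lefschetz group: restriction to the blocks is an INJECTIVE homomorphism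
`r : S(H)(ℚ) →* Π_k S(W_k)(ℚ)`, `(r g)_k v = g v`**, for every internal direct sum of sub-Hodge structures.
[cite: Milne1999LefschetzClasses, §1 p. 643–644 and Prop. 1.5] -/
theorem Polarization.exists_monoidHom_pi_lefschetzGroup (ψ : Polarization H) :
    ∃ r : ψ.lefschetzGroup →* Π k, (ψ.restrict (W k)).lefschetzGroup,
      (∀ (g : ψ.lefschetzGroup) (k : κ) (v : (W k).toSubmodule),
        ((r g k : (W k).toSubmodule ≃ₗ[ℚ] (W k).toSubmodule) v : V) = (g : V ≃ₗ[ℚ] V) v) ∧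
      Function.Injective r := by
  let r : ψ.lefschetzGroup →* Π k, (ψ.restrict (W k)).lefschetzGroup :=
    { toFun := fun g k => ⟨(g : V ≃ₗ[ℚ] V).ofSubmodules (W k).toSubmodule (W k).toSubmodule
          (ψ.map_eq_of_mem_lefschetzGroup W hW g.2 k), ψ.ofSubmodules_mem_lefschetzGroup_restrict W hW g.2 k⟩
      map_one' := funext fun k => Subtype.ext (LinearEquiv.ext fun v => Subtype.ext rfl)
      map_mul' := fun g g' => funext fun k => Subtype.ext (LinearEquiv.ext fun v => Subtype.ext rfl) }
  have hr : ∀ (g : ψ.lefschetzGroup) (k : κ) (v : (W k).toSubmodule),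
      ((r g k : (W k).toSubmodule ≃ₗ[ℚ] (W k).toSubmodule) v : V) = (g : V ≃ₗ[ℚ] V) v := fun _ _ _ => rfl
  refine ⟨r, hr, (injective_iff_map_eq_one r).2 fun g hg => Subtype.ext (LinearEquiv.ext fun v => ?_)⟩
  change (g : V ≃ₗ[ℚ] V) v = v
  rw [← sum_isInternalProj_apply hW Finset.univ (fun j hj => absurd (Finset.mem_univ j) hj) v, map_sum]
  refine Finset.sum_congr rfl fun k _ => ?_
  have h1 : (g : V ≃ₗ[ℚ] V) (isInternalProj hW k v) =
      ((r g k : (W k).toSubmodule ≃ₗ[ℚ] (W k).toSubmodule) ⟨isInternalProj hW k v, isInternalProj_apply_mem hW k v⟩ : V) := by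
    rw [hr]
  rw [h1, hg, Pi.one_apply, OneMemClass.coe_one]
  rfl

/-! ## §2 Hom-orthogonal blocks: gluing, `S(H)(ℚ) ≃* Π_k S(W_k)(ℚ)` -/

variable (horth : ∀ k l, k ≠ l → ∀ f : Hom (W k).toHodgeStructure (W l).toHodgeStructure, f = 0)

include horth

/-- **`ψ(v, w) = Σ_k ψ(π_k v, π_k w)` for Hom-orthogonal blocks** (they are `ψ`-orthogonal for every `ψ`, so `ψ` is the gluing of
its restrictions). [cite: Milne1999LefschetzClasses, §1 p. 644] [cite: VoisinHodgeI2002, §7.3.1 Lemma 7.26] -/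
theorem Polarization.form_eq_sum_isInternalProj_of_hom_orthogonal (ψ : Polarization H) (v w : V) :
    ψ.form v w = ∑ k, ψ.form (isInternalProj hW k v) (isInternalProj hW k w) := by
  have h0 : ∀ k l, k ≠ l → ∀ φ : Hom (W k).toHodgeStructure (W l).toHodgeStructure, φ.toLinearMap = 0 :=
    fun k l hkl φ => by rw [horth k l hkl φ, Hom.zero_toLinearMap]
  conv_lhs => rw [← ψ.glueFamily_restrict_eq_of_pairwise_hom_eq_zero W hW h0]
  rw [Polarization.glueFamily_form_apply]
  refine Finset.sum_congr rfl fun k _ => ?_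
  rw [Polarization.restrict_form_apply, SubHodgeStructure.coe_internalProjOntoHom_apply,
    SubHodgeStructure.coe_internalProjOntoHom_apply]

/-- **GLUING: every family `γ_k ∈ S(W_k)(ℚ)` of a Hom-orthogonal internal direct sum comes from some `g ∈ S(H)(ℚ)`**
(`g = Σ_k ι_k γ_k π_k` commutes with `E_φ` by g52-#3, preserves `ψ = Σ_k ψ|_{W_k} ∘ π_k` block by block, and is injective by
non-degeneracy, hence an automorphism). [cite: Milne1999LefschetzClasses, §1 Prop. 1.5 (p. 644)] [cite: Moonen2004MT, §4 Lemma 4.6] -/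
theorem Polarization.exists_mem_lefschetzGroup_forall_apply_eq_of_hom_orthogonal (ψ : Polarization H)
    (γ : Π k, (ψ.restrict (W k)).lefschetzGroup) :
    ∃ g ∈ ψ.lefschetzGroup, ∀ (k : κ) (v : (W k).toSubmodule),
      g (v : V) = ((γ k : (W k).toSubmodule ≃ₗ[ℚ] (W k).toSubmodule) v : V) := by
  -- the glued linear map `F = Σ_k ι_k γ_k π_k`
  obtain ⟨F, hF⟩ : ∃ F : Module.End ℚ V, F = ∑ k, (W k).toSubmodule.subtype ∘ₗ
      ((γ k : (W k).toSubmodule ≃ₗ[ℚ] (W k).toSubmodule) : Module.End ℚ (W k).toSubmodule) ∘ₗ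
        (isInternalProj hW k).codRestrict (W k).toSubmodule (isInternalProj_apply_mem hW k) := ⟨_, rfl⟩
  have hFapply : ∀ (k : κ) (v : V) (hv : v ∈ (W k).toSubmodule),
      F v = ((γ k : (W k).toSubmodule ≃ₗ[ℚ] (W k).toSubmodule) ⟨v, hv⟩ : V) := fun k v hv => by
    rw [hF]
    exact sum_subtype_comp_comp_codRestrict_apply_of_mem W hW _ hv
  -- `F ∈ C(H)`
  have hFC : F ∈ Subalgebra.centralizer ℚ (H.endAlg : Set (Module.End ℚ V)) := by
    rw [hF]
    exact sum_comp_mem_centralizer_endAlg_of_hom_orthogonal W hW horth fun k =>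
      ⟨((γ k : (W k).toSubmodule ≃ₗ[ℚ] (W k).toSubmodule) : Module.End ℚ (W k).toSubmodule),
        (forall_endAlg_apply_iff_coe_mem_centralizer_endAlg _ _).1
          (((ψ.restrict (W k)).mem_lefschetzGroup_iff _).1 (γ k).2).1⟩
  have hcommπ : ∀ (k : κ) (v : V), isInternalProj hW k (F v) = F (isInternalProj hW k v) := fun k v =>
    LinearMap.congr_fun ((Subalgebra.mem_centralizer_iff ℚ).1 hFC _ (isInternalProj_mem_endAlg' W hW k)) v
  -- `F` preserves `ψ`
  have hFform : ∀ v w, ψ.form (F v) (F w) = ψ.form v w := by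
    intro v w
    rw [ψ.form_eq_sum_isInternalProj_of_hom_orthogonal W hW horth (F v) (F w),
      ψ.form_eq_sum_isInternalProj_of_hom_orthogonal W hW horth v w]
    refine Finset.sum_congr rfl fun k _ => ?_
    rw [hcommπ k v, hcommπ k w, hFapply k _ (isInternalProj_apply_mem hW k v),
      hFapply k _ (isInternalProj_apply_mem hW k w), ← ψ.restrict_form_apply (W k),
      (((ψ.restrict (W k)).mem_lefschetzGroup_iff _).1 (γ k).2).2, ψ.restrict_form_apply]
  -- `F` is injective (non-degeneracy), hence an automorphism
  have hinj : Function.Injective F := by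
    rw [injective_iff_map_eq_zero]
    intro v hv
    refine ψ.nondegenerate.1 v fun w => ?_
    rw [← hFform v w, hv, map_zero, LinearMap.zero_apply]
  refine ⟨LinearEquiv.ofInjectiveEndo F hinj, (ψ.mem_lefschetzGroup_iff _).2 ⟨fun a v => ?_, fun v w => hFform v w⟩,
    fun k v => ?_⟩
  · change (a : Module.End ℚ V) (F v) = F ((a : Module.End ℚ V) v)
    exact LinearMap.congr_fun ((Subalgebra.mem_centralizer_iff ℚ).1 hFC _ a.2) v
  · change F (v : V) = _
    rw [hFapply k _ v.2]

/-- **MILNE'S PROP. 1.5, internal form: `S(H)(ℚ) ≃* Π_k S(W_k)(ℚ)` along a Hom-orthogonal internal direct sum of sub-Hodge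
structures** (`(e g)_k v = g v`; injective by §1, surjective by gluing). [cite: Milne1999LefschetzClasses, §1 Prop. 1.5 (p. 644)]
[cite: Lange2023AbelianVarietiesComplex, §7.2.4 Exercise (4)] -/
theorem Polarization.exists_mulEquiv_pi_lefschetzGroup_of_hom_orthogonal (ψ : Polarization H) :
    ∃ e : ψ.lefschetzGroup ≃* Π k, (ψ.restrict (W k)).lefschetzGroup,
      ∀ (g : ψ.lefschetzGroup) (k : κ) (v : (W k).toSubmodule),
        ((e g k : (W k).toSubmodule ≃ₗ[ℚ] (W k).toSubmodule) v : V) = (g : V ≃ₗ[ℚ] V) v := by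
  obtain ⟨r, hr, hinj⟩ := ψ.exists_monoidHom_pi_lefschetzGroup W hW
  have hsurj : Function.Surjective r := fun γ => by
    obtain ⟨g, hg, hgγ⟩ := ψ.exists_mem_lefschetzGroup_forall_apply_eq_of_hom_orthogonal W hW horth γ
    exact ⟨⟨g, hg⟩, funext fun k => Subtype.ext (LinearEquiv.ext fun v => Subtype.ext (by rw [hr]; exact hgγ k v))⟩
  exact ⟨MulEquiv.ofBijective r ⟨hinj, hsurj⟩, hr⟩

omit horth in
/-- **`S(H)(ℚ) ≃* Π_k S(W_k)(ℚ)` along an internal direct sum into `E_φ`-STABLE sub-Hodge structures** (stable blocks are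
Hom-orthogonal, g52-#3). [cite: Milne1999LefschetzClasses, §1 Prop. 1.5 (p. 644)] -/
theorem Polarization.exists_mulEquiv_pi_lefschetzGroup_of_forall_stable (ψ : Polarization H)
    (hst : ∀ k, ∀ a ∈ H.endAlg, ∀ v ∈ (W k).toSubmodule, a v ∈ (W k).toSubmodule) :
    ∃ e : ψ.lefschetzGroup ≃* Π k, (ψ.restrict (W k)).lefschetzGroup,
      ∀ (g : ψ.lefschetzGroup) (k : κ) (v : (W k).toSubmodule),
        ((e g k : (W k).toSubmodule ≃ₗ[ℚ] (W k).toSubmodule) v : V) = (g : V ≃ₗ[ℚ] V) v :=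
  ψ.exists_mulEquiv_pi_lefschetzGroup_of_hom_orthogonal W hW fun _ _ hkl f => hom_eq_zero_of_forall_stable W hW hst hkl f

end Blocks

/-! ## §3 The canonical blocks: `S(H)(ℚ) ≃* Π_i S(S_i)(ℚ)` over the minimal `E_φ`-stable sub-Hodge structures -/

section Canonical

open Classical in
/-- **«`S(A₁) × ⋯ × S(A_s) → S(A)` is an isomorphism» INTRINSICALLY: `S(H)(ℚ) ≃* Π_i S(S_i)(ℚ)` over the CANONICAL blocks** —
the minimal `E_φ`-stable sub-Hodge structures `S_i` of a polarized `ℚ`-Hodge structure (`V = ⊕_i S_i`, Hom-orthogonal,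
g51-#8∕#9), each with its restricted polarization `ψ|_{S_i}`; `(e g)_i v = g v`.
[cite: Milne1999LefschetzClasses, §1 Prop. 1.5 (p. 644)] [cite: Lange2023AbelianVarietiesComplex, §2.4.4 Cor. 2.4.26 (p. 124) and §7.2.4 Exercise (4)] -/
theorem Polarization.exists_mulEquiv_pi_lefschetzGroup_minimal_stable (ψ : Polarization H) :
    ∃ e : ψ.lefschetzGroup ≃*
        Π S : {S : SubHodgeStructure H // (∀ a ∈ H.endAlg, ∀ v ∈ S.toSubmodule, a v ∈ S.toSubmodule) ∧ S.toSubmodule ≠ ⊥ ∧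
      ∀ S' : SubHodgeStructure H, (∀ a ∈ H.endAlg, ∀ v ∈ S'.toSubmodule, a v ∈ S'.toSubmodule) →
        S'.toSubmodule ≤ S.toSubmodule → S'.toSubmodule = ⊥ ∨ S'.toSubmodule = S.toSubmodule},
          (ψ.restrict (S : SubHodgeStructure H)).lefschetzGroup,
      ∀ (g : ψ.lefschetzGroup) (S : {S : SubHodgeStructure H // (∀ a ∈ H.endAlg, ∀ v ∈ S.toSubmodule, a v ∈ S.toSubmodule) ∧ S.toSubmodule ≠ ⊥ ∧
      ∀ S' : SubHodgeStructure H, (∀ a ∈ H.endAlg, ∀ v ∈ S'.toSubmodule, a v ∈ S'.toSubmodule) →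
        S'.toSubmodule ≤ S.toSubmodule → S'.toSubmodule = ⊥ ∨ S'.toSubmodule = S.toSubmodule})
          (v : (S : SubHodgeStructure H).toSubmodule),
        ((e g S : (S : SubHodgeStructure H).toSubmodule ≃ₗ[ℚ] (S : SubHodgeStructure H).toSubmodule) v : V) =
          (g : V ≃ₗ[ℚ] V) v := by
  haveI : Fintype {S : SubHodgeStructure H // (∀ a ∈ H.endAlg, ∀ v ∈ S.toSubmodule, a v ∈ S.toSubmodule) ∧ S.toSubmodule ≠ ⊥ ∧
      ∀ S' : SubHodgeStructure H, (∀ a ∈ H.endAlg, ∀ v ∈ S'.toSubmodule, a v ∈ S'.toSubmodule) →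
        S'.toSubmodule ≤ S.toSubmodule → S'.toSubmodule = ⊥ ∨ S'.toSubmodule = S.toSubmodule} :=
    ψ.finite_setOf_minimal_stable.fintype
  exact ψ.exists_mulEquiv_pi_lefschetzGroup_of_hom_orthogonal
    (Subtype.val : {S : SubHodgeStructure H // (∀ a ∈ H.endAlg, ∀ v ∈ S.toSubmodule, a v ∈ S.toSubmodule) ∧ S.toSubmodule ≠ ⊥ ∧
      ∀ S' : SubHodgeStructure H, (∀ a ∈ H.endAlg, ∀ v ∈ S'.toSubmodule, a v ∈ S'.toSubmodule) →
        S'.toSubmodule ≤ S.toSubmodule → S'.toSubmodule = ⊥ ∨ S'.toSubmodule = S.toSubmodule} → SubHodgeStructure H)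
    ψ.isInternal_minimal_stable
    fun S S' hne f => ψ.hom_eq_zero_of_minimal_stable_of_ne S.2 S'.2 (fun h => hne (Subtype.ext h)) f

end Canonical

end HodgeStructure

end Literature.AlgebraicGeometry.Motives
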